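import Mathlib
import HarnessLib

/-!
# Sly's first-moment exponent `Φ₁` for the hard-core model on random bipartite regular graphs

The function
`Φ₁(α, β) = (α+β) log λ - α log α - β log β - d(1-α-β) log(1-α-β) + (d-1)((1-α) log(1-α) + (1-β) log(1-β))`
of Sly 2010, §1.3 (after Mossel–Weitz–Wormald 2009 and Dyer–Frieze–Jerrum 2002): the exponential
rate of the first moment of the hard-core partition function of the random bipartite `d`-regular
(multi)graph restricted to configurations with densities `α`, `β` on the two sides,
`E Z^{α,β}_{MWW} ≈ exp(n Φ₁(α,β))` (MWW09 Prop. 3.1; the exact first moment is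
`Literature.Computability.Complexity.mww_firstMoment`, and `(1/n) log` of it tends to `Φ₁` by
Stirling). It governs Sly's Theorem 2.1 through "(p⁺, p⁻) and (p⁻, p⁺) are the maxima of `Φ₁` in
`T`" (Sly §1.3, quoting [MWW09, §4] and [DFJ02, Claim 2.2]). This file DEFINES `Φ₁` (`slyPhi1`) and
proves the one-variable calculus behind that claim: the partial derivative in `β`
(`hasDerivAt_slyPhi1_right`), its zero set — the critical equation `λ(1-α-β)^d = β(1-β)^{d-1}`,
i.e. DFJ's `β = h(α)` (`deriv_slyPhi1_right_eq_zero_iff`) — and strict concavity of `Φ₁(α, ·)` on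
`(0, 1-α)` for `0 ≤ α` (`strictConcaveOn_slyPhi1_right`), whence by the symmetry `Φ₁(α, β) = Φ₁(β, α)`
(`slyPhi1_comm`) the same in `α`; and the conclusion `slyPhi1_right_critical_unique_max`: for `0 < α < 1` the
section `Φ₁(α, ·)` has exactly one critical point `β_α ∈ (0, 1-α)` (`α = h(β_α)`), its strict
maximum (`∂_β Φ₁ → +∞` at `0⁺`, `→ -∞` at `(1-α)⁻`, intermediate value theorem, monotonicity on
either side).

DFJ's function `h` is `dfjH`, and `slyPhi1_critical_iff_eq_dfjH` identifies the critical equation in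
`β` with `α = h(β)` literally (taking `d`-th roots).

## What is NOT here

The identification of the critical points with `(p^{±}, p^{∓})`, `(p*, p*)` and the global
maximisation on `T = {α, β ≥ 0, α + β ≤ 1}` (DFJ02 Claim 2.2, MWW09 §4), the second-moment exponent
`f(α,β,γ,δ,ε)` and Sly's Condition 1.2.

## References

* A. Sly, *Computational transition at the uniqueness threshold*, FOCS 2010, arXiv:1005.5584, §1.3
  (Preliminaries: the display defining `Φ₁` and the two bullet points quoted from [MWW09, §4],
  [DFJ02, Claim 2.2]) [Sly2010].
* E. Mossel, D. Weitz, N. Wormald, Probab. Theory Related Fields 143 (2009), Prop. 3.1, §4.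
* M. Dyer, A. Frieze, M. Jerrum, SIAM J. Comput. 31 (2002), Claim 2.2.
-/

namespace Literature.Computability.Complexity

open Real Set

/-- **Sly's first-moment exponent** `Φ₁(α, β) = (α+β) log λ - α log α - β log β
- d(1-α-β) log(1-α-β) + (d-1)((1-α) log(1-α) + (1-β) log(1-β))` for the hard-core model at
activity `λ` on the random bipartite `d`-regular graph, as a function of the densities `α`, `β` of
the configuration on the two sides. [cite: Sly2010, §1.3 (display defining `Φ₁`)] -/
noncomputable def slyPhi1 (d : ℕ) (lam α β : ℝ) : ℝ :=
  (α + β) * Real.log lam - α * Real.log α - β * Real.log β -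
      d * (1 - α - β) * Real.log (1 - α - β) +
    (d - 1) * ((1 - α) * Real.log (1 - α) + (1 - β) * Real.log (1 - β))

/-- Unfolding lemma for `slyPhi1`. [cite: Sly2010, §1.3 (display defining `Φ₁`)] -/
theorem slyPhi1_def (d : ℕ) (lam α β : ℝ) :
    slyPhi1 d lam α β =
      (α + β) * Real.log lam - α * Real.log α - β * Real.log β -
          d * (1 - α - β) * Real.log (1 - α - β) +
        (d - 1) * ((1 - α) * Real.log (1 - α) + (1 - β) * Real.log (1 - β)) := rfl

/-- `Φ₁` is symmetric in the two densities. [folklore] -/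
theorem slyPhi1_comm (d : ℕ) (lam α β : ℝ) : slyPhi1 d lam α β = slyPhi1 d lam β α := by
  unfold slyPhi1
  rw [show 1 - β - α = 1 - α - β by ring]
  ring

/-- **The partial derivative of `Φ₁` in `β`**: for `α ≥ 0`, `β > 0` and `α + β < 1`,
`∂_β Φ₁(α, β) = log λ - log β + d log(1-α-β) - (d-1) log(1-β)` (the constants of the four
`x log x` derivatives cancel). [cite: Sly2010, §1.3 (the critical points of `Φ₁`, after DFJ02 Claim 2.2)] -/
theorem hasDerivAt_slyPhi1_right (d : ℕ) (lam : ℝ) {α β : ℝ} (hα : 0 ≤ α) (hβ : 0 < β)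
    (hαβ : α + β < 1) :
    HasDerivAt (fun b => slyPhi1 d lam α b)
      (Real.log lam - Real.log β + d * Real.log (1 - α - β) - (d - 1) * Real.log (1 - β)) β := by
  have h1 : 0 < 1 - α - β := by linarith
  have h2 : 0 < 1 - β := by linarith
  -- the four elementary pieces
  have e1 : HasDerivAt (fun b : ℝ => (α + b) * Real.log lam) (1 * Real.log lam) β :=
    ((hasDerivAt_id' β).const_add α).mul_const (Real.log lam)
  have e2 : HasDerivAt (fun b : ℝ => b * Real.log b) (Real.log β + 1) β :=
    Real.hasDerivAt_mul_log hβ.ne'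
  have hu : HasDerivAt (fun b : ℝ => 1 - α - b) (-1) β := by
    simpa using (hasDerivAt_id' β).const_sub (1 - α)
  have hv : HasDerivAt (fun b : ℝ => 1 - b) (-1) β := by
    simpa using (hasDerivAt_id' β).const_sub 1
  have e3 : HasDerivAt (fun b : ℝ => (1 - α - b) * Real.log (1 - α - b))
      (-1 * Real.log (1 - α - β) + (1 - α - β) * (-1 / (1 - α - β))) β := hu.mul (hu.log h1.ne')
  have e4 : HasDerivAt (fun b : ℝ => (1 - b) * Real.log (1 - b))
      (-1 * Real.log (1 - β) + (1 - β) * (-1 / (1 - β))) β := hv.mul (hv.log h2.ne')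
  -- assemble
  have e5 := ((e1.sub (hasDerivAt_const β (α * Real.log α))).sub e2).sub (e3.const_mul (d : ℝ))
  have e6 := e5.add ((e4.const_add ((1 - α) * Real.log (1 - α))).const_mul ((d : ℝ) - 1))
  have e7 := e6.congr_deriv (show _ = Real.log lam - Real.log β + d * Real.log (1 - α - β) -
      (d - 1) * Real.log (1 - β) by field_simp; ring)
  refine e7.congr_of_eventuallyEq (Filter.Eventually.of_forall fun b => ?_)
  simp only [slyPhi1, Pi.sub_apply, Pi.add_apply]
  ring

/-- **The critical equation in `β`** (DFJ's `β = h(α)`): for `λ, β > 0`, `α ≥ 0`, `α + β < 1`,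
`∂_β Φ₁(α, β) = 0 ⟺ λ (1-α-β)^d = β (1-β)^{d-1}`.
[cite: Sly2010, §1.3 ("the solutions to `h(α) = β`, `h(β) = α` … are exactly `(p⁺,p⁻)`, `(p⁻,p⁺)` and `(p*,p*)`", after DFJ02 Claim 2.2)] -/
theorem deriv_slyPhi1_right_eq_zero_iff (d : ℕ) (hd : 1 ≤ d) {lam α β : ℝ} (hlam : 0 < lam)
    (hα : 0 ≤ α) (hβ : 0 < β) (hαβ : α + β < 1) :
    Real.log lam - Real.log β + d * Real.log (1 - α - β) - (d - 1) * Real.log (1 - β) = 0 ↔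
      lam * (1 - α - β) ^ d = β * (1 - β) ^ (d - 1) := by
  have h1 : 0 < 1 - α - β := by linarith
  have h2 : 0 < 1 - β := by linarith
  have hL : Real.log (lam * (1 - α - β) ^ d) = Real.log lam + d * Real.log (1 - α - β) := by
    rw [Real.log_mul hlam.ne' (pow_ne_zero _ h1.ne'), Real.log_pow]
  have hR : Real.log (β * (1 - β) ^ (d - 1)) = Real.log β + (d - 1 : ℝ) * Real.log (1 - β) := by
    rw [Real.log_mul hβ.ne' (pow_ne_zero _ h2.ne'), Real.log_pow, Nat.cast_sub hd, Nat.cast_one]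
  constructor
  · intro h
    have : Real.log (lam * (1 - α - β) ^ d) = Real.log (β * (1 - β) ^ (d - 1)) := by
      rw [hL, hR]; linarith
    exact Real.log_injOn_pos (Set.mem_Ioi.2 (by positivity)) (Set.mem_Ioi.2 (by positivity)) this
  · intro h
    have : Real.log (lam * (1 - α - β) ^ d) = Real.log (β * (1 - β) ^ (d - 1)) := by rw [h]
    rw [hL, hR] at this
    linarith

/-- **The second partial derivative of `Φ₁` in `β`**: for `α ≥ 0`, `β > 0`, `α + β < 1`,
`∂²_β Φ₁(α, β) = -1/β - d/(1-α-β) + (d-1)/(1-β)`. [folklore] -/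
theorem hasDerivAt_deriv_slyPhi1_right (d : ℕ) (lam : ℝ) {α β : ℝ} (hα : 0 ≤ α) (hβ : 0 < β)
    (hαβ : α + β < 1) :
    HasDerivAt (fun b => Real.log lam - Real.log b + d * Real.log (1 - α - b) - (d - 1) * Real.log (1 - b))
      (-β⁻¹ - d * (1 - α - β)⁻¹ + (d - 1) * (1 - β)⁻¹) β := by
  have h1 : 0 < 1 - α - β := by linarith
  have h2 : 0 < 1 - β := by linarith
  have e1 : HasDerivAt (fun b : ℝ => Real.log b) β⁻¹ β := Real.hasDerivAt_log hβ.ne'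
  have hu : HasDerivAt (fun b : ℝ => 1 - α - b) (-1) β := by
    simpa using (hasDerivAt_id' β).const_sub (1 - α)
  have hv : HasDerivAt (fun b : ℝ => 1 - b) (-1) β := by
    simpa using (hasDerivAt_id' β).const_sub 1
  have e2 : HasDerivAt (fun b : ℝ => Real.log (1 - α - b)) (-1 / (1 - α - β)) β := hu.log h1.ne'
  have e3 : HasDerivAt (fun b : ℝ => Real.log (1 - b)) (-1 / (1 - β)) β := hv.log h2.ne'
  have e4 := (((hasDerivAt_const β (Real.log lam)).sub e1).add (e2.const_mul (d : ℝ))).sub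
    (e3.const_mul ((d : ℝ) - 1))
  exact e4.congr_deriv (by field_simp; ring)

/-- The second partial derivative of `Φ₁` in `β` is negative on `{β > 0, α + β < 1}` (for
`α ≥ 0`): `-1/β - d/(1-α-β) + (d-1)/(1-β) ≤ -1/β - 1/(1-α-β) < 0`, as `1 - β ≥ 1 - α - β`. [folklore] -/
theorem deriv2_slyPhi1_right_neg (d : ℕ) {α β : ℝ} (hα : 0 ≤ α) (hβ : 0 < β) (hαβ : α + β < 1) :
    -β⁻¹ - d * (1 - α - β)⁻¹ + (d - 1) * (1 - β)⁻¹ < 0 := by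
  have h1 : 0 < 1 - α - β := by linarith
  have h2 : 0 < 1 - β := by linarith
  have hinv : (1 - β)⁻¹ ≤ (1 - α - β)⁻¹ := by
    rw [inv_le_inv₀ h2 h1]; linarith
  have hd0 : (0 : ℝ) ≤ d := Nat.cast_nonneg d
  have hb : 0 < β⁻¹ := inv_pos.2 hβ
  have hc : 0 < (1 - α - β)⁻¹ := inv_pos.2 h1
  have hc2 : 0 < (1 - β)⁻¹ := inv_pos.2 h2
  nlinarith [mul_le_mul_of_nonneg_left hinv hd0]

/-- **Strict concavity of `Φ₁(α, ·)`** on `(0, 1 - α)` for `0 ≤ α < 1`: for fixed density on one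
side, the first-moment exponent is a strictly concave function of the density on the other side, so
its section has at most one critical point `β = h(α)`, which is then its strict maximum (the
reduction behind DFJ02 Claim 2.2 / MWW09 §4 as quoted in Sly §1.3). [cite: Sly2010, §1.3 (maxima of `Φ₁`, after DFJ02 Claim 2.2)] -/
theorem strictConcaveOn_slyPhi1_right (d : ℕ) (lam : ℝ) {α : ℝ} (hα : 0 ≤ α) :
    StrictConcaveOn ℝ (Set.Ioo 0 (1 - α)) (fun b => slyPhi1 d lam α b) := by
  have hD : ∀ b ∈ Set.Ioo 0 (1 - α), HasDerivAt (fun b => slyPhi1 d lam α b)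
      (Real.log lam - Real.log b + d * Real.log (1 - α - b) - (d - 1) * Real.log (1 - b)) b :=
    fun b hb => hasDerivAt_slyPhi1_right d lam hα hb.1 (by linarith [hb.2])
  refine strictConcaveOn_of_deriv2_neg (convex_Ioo 0 (1 - α))
    (fun b hb => (hD b hb).continuousAt.continuousWithinAt) fun b hb => ?_
  rw [interior_Ioo] at hb
  -- `deriv f = f'` near `b`, so `deriv^[2] f b = deriv f' b`
  have hev : deriv (fun b => slyPhi1 d lam α b) =ᶠ[nhds b]
      fun b => Real.log lam - Real.log b + d * Real.log (1 - α - b) - (d - 1) * Real.log (1 - b) := by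
    filter_upwards [Ioo_mem_nhds hb.1 hb.2] with x hx
    exact (hD x hx).deriv
  change deriv (deriv fun b => slyPhi1 d lam α b) b < 0
  rw [hev.deriv_eq, (hasDerivAt_deriv_slyPhi1_right d lam hα hb.1 (by linarith [hb.2])).deriv]
  exact deriv2_slyPhi1_right_neg d hα hb.1 (by linarith [hb.2])

/-- **The section `Φ₁(α, ·)` has exactly one critical point, its strict maximum** (the reduction
behind DFJ02 Claim 2.2 / MWW09 §4 quoted in Sly §1.3): for `d ≥ 1`, `λ > 0` and `0 < α < 1` there
is a unique `β_α ∈ (0, 1-α)` with `λ(1-α-β_α)^d = β_α(1-β_α)^{d-1}` (i.e. `α = h(β_α)`), and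
`Φ₁(α, β) < Φ₁(α, β_α)` for every other `β ∈ (0, 1-α)`. Proof: `∂_β Φ₁(α, ·)` is continuous and
strictly decreasing on `(0, 1-α)` (`deriv2_slyPhi1_right_neg`), tends to `+∞` at `0⁺` (the term
`-log β`) and to `-∞` at `(1-α)⁻` (the term `d log(1-α-β)`), so it vanishes exactly once
(intermediate value theorem), and `Φ₁(α, ·)` increases before and decreases after.
[cite: Sly2010, §1.3 (first bullet: the critical points of `Φ₁`, after DFJ02 Claim 2.2)] -/
theorem slyPhi1_right_critical_unique_max (d : ℕ) (hd : 1 ≤ d) {lam α : ℝ} (hlam : 0 < lam)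
    (hα : 0 < α) (hα1 : α < 1) :
    ∃ βs : ℝ, 0 < βs ∧ βs < 1 - α ∧ lam * (1 - α - βs) ^ d = βs * (1 - βs) ^ (d - 1) ∧
      (∀ β : ℝ, 0 < β → β < 1 - α → lam * (1 - α - β) ^ d = β * (1 - β) ^ (d - 1) → β = βs) ∧
      (∀ β : ℝ, 0 < β → β < 1 - α → β ≠ βs → slyPhi1 d lam α β < slyPhi1 d lam α βs) := by
  have hα0 : 0 ≤ α := hα.le
  have hd0 : (0 : ℝ) < d := by exact_mod_cast hd
  set g : ℝ → ℝ := fun b => Real.log lam - Real.log b + d * Real.log (1 - α - b) -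
    (d - 1) * Real.log (1 - b) with hg
  -- `g = ∂_β Φ₁(α, ·)` is continuous and strictly decreasing on `(0, 1 - α)`
  have hg_deriv : ∀ b ∈ Set.Ioo 0 (1 - α),
      HasDerivAt g (-b⁻¹ - d * (1 - α - b)⁻¹ + (d - 1) * (1 - b)⁻¹) b :=
    fun b hb => hasDerivAt_deriv_slyPhi1_right d lam hα0 hb.1 (by linarith [hb.2])
  have hg_cont : ContinuousOn g (Set.Ioo 0 (1 - α)) :=
    fun b hb => (hg_deriv b hb).continuousAt.continuousWithinAt
  have hg_anti : StrictAntiOn g (Set.Ioo 0 (1 - α)) := by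
    refine strictAntiOn_of_deriv_neg (convex_Ioo _ _) hg_cont fun b hb => ?_
    rw [interior_Ioo] at hb
    rw [(hg_deriv b hb).deriv]
    exact deriv2_slyPhi1_right_neg d hα0 hb.1 (by linarith [hb.2])
  -- the affine inner maps
  have hu : ∀ b : ℝ, HasDerivAt (fun b : ℝ => 1 - α - b) (-1) b := fun b => by
    simpa using (hasDerivAt_id' b).const_sub (1 - α)
  have hv : ∀ b : ℝ, HasDerivAt (fun b : ℝ => 1 - b) (-1) b := fun b => by
    simpa using (hasDerivAt_id' b).const_sub 1
  -- limit `+∞` at `0⁺`: `g = -log b + r b` with `r` continuous at `0`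
  have hlim0 : Filter.Tendsto g (nhdsWithin 0 (Set.Ioi 0)) Filter.atTop := by
    set r : ℝ → ℝ := fun b => Real.log lam + d * Real.log (1 - α - b) - (d - 1) * Real.log (1 - b)
      with hr
    have hr0 : ContinuousAt r 0 := by
      have e2 := ((hu 0).log (by norm_num; linarith)).const_mul (d : ℝ)
      have e3 := ((hv 0).log (by norm_num)).const_mul ((d : ℝ) - 1)
      exact (((hasDerivAt_const (0 : ℝ) (Real.log lam)).add e2).sub e3).continuousAt
    have h1 : Filter.Tendsto (fun b : ℝ => -Real.log b) (nhdsWithin 0 (Set.Ioi 0)) Filter.atTop :=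
      Filter.tendsto_neg_atBot_atTop.comp Real.tendsto_log_nhdsGT_zero
    have h2 : Filter.Tendsto r (nhdsWithin 0 (Set.Ioi 0)) (nhds (r 0)) :=
      hr0.tendsto.mono_left nhdsWithin_le_nhds
    have h3 := h1.atTop_add h2
    refine h3.congr fun b => ?_
    simp only [hg, hr]
    ring
  -- limit `-∞` at `(1-α)⁻`: `g = d log(1-α-b) + r' b` with `r'` continuous at `1 - α`
  have hlim1 : Filter.Tendsto g (nhdsWithin (1 - α) (Set.Iio (1 - α))) Filter.atBot := by
    set r : ℝ → ℝ := fun b => Real.log lam - Real.log b - (d - 1) * Real.log (1 - b) with hr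
    have hr1 : ContinuousAt r (1 - α) := by
      have e1 := Real.hasDerivAt_log (show (1 : ℝ) - α ≠ 0 by linarith)
      have e3 := ((hv (1 - α)).log (by ring_nf; exact hα.ne')).const_mul ((d : ℝ) - 1)
      exact (((hasDerivAt_const (1 - α : ℝ) (Real.log lam)).sub e1).sub e3).continuousAt
    have hsub : Filter.Tendsto (fun b : ℝ => 1 - α - b) (nhdsWithin (1 - α) (Set.Iio (1 - α)))
        (nhdsWithin 0 (Set.Ioi 0)) := by
      rw [tendsto_nhdsWithin_iff]
      constructor
      · have : Filter.Tendsto (fun b : ℝ => 1 - α - b) (nhds (1 - α)) (nhds (1 - α - (1 - α))) :=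
          ((hu (1 - α)).continuousAt).tendsto
        rw [sub_self] at this
        exact this.mono_left nhdsWithin_le_nhds
      · filter_upwards [self_mem_nhdsWithin] with b hb
        exact Set.mem_Ioi.2 (by simpa using hb)
    have h1 : Filter.Tendsto (fun b : ℝ => (d : ℝ) * Real.log (1 - α - b))
        (nhdsWithin (1 - α) (Set.Iio (1 - α))) Filter.atBot :=
      Filter.Tendsto.const_mul_atBot hd0 (Real.tendsto_log_nhdsGT_zero.comp hsub)
    have h2 : Filter.Tendsto r (nhdsWithin (1 - α) (Set.Iio (1 - α))) (nhds (r (1 - α))) :=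
      hr1.tendsto.mono_left nhdsWithin_le_nhds
    have h3 := h1.atBot_add h2
    refine h3.congr fun b => ?_
    simp only [hg, hr]
    ring
  -- points where `g > 0` and `g < 0`, separated by `(1 - α)/2`
  obtain ⟨b₁, hb₁0, hb₁1, hgb₁⟩ : ∃ b₁, 0 < b₁ ∧ b₁ < (1 - α) / 2 ∧ 0 < g b₁ := by
    have h1 : ∀ᶠ b in nhdsWithin 0 (Set.Ioi 0), 0 < g b := hlim0.eventually (Filter.eventually_gt_atTop 0)
    have h2 : ∀ᶠ b in nhdsWithin (0 : ℝ) (Set.Ioi 0), b ∈ Set.Ioo 0 ((1 - α) / 2) :=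
      Ioo_mem_nhdsGT (by linarith)
    obtain ⟨b, hb, hb'⟩ := (h1.and h2).exists
    exact ⟨b, hb'.1, hb'.2, hb⟩
  obtain ⟨b₂, hb₂0, hb₂1, hgb₂⟩ : ∃ b₂, (1 - α) / 2 < b₂ ∧ b₂ < 1 - α ∧ g b₂ < 0 := by
    have h1 : ∀ᶠ b in nhdsWithin (1 - α) (Set.Iio (1 - α)), g b < 0 :=
      hlim1.eventually (Filter.eventually_lt_atBot 0)
    have h2 : ∀ᶠ b in nhdsWithin (1 - α) (Set.Iio (1 - α)), b ∈ Set.Ioo ((1 - α) / 2) (1 - α) :=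
      Ioo_mem_nhdsLT (by linarith)
    obtain ⟨b, hb, hb'⟩ := (h1.and h2).exists
    exact ⟨b, hb'.1, hb'.2, hb⟩
  -- the critical point, by the intermediate value theorem
  obtain ⟨βs, ⟨hβs1, hβs2⟩, hgβs⟩ : ∃ βs ∈ Set.Ioo b₁ b₂, g βs = 0 := by
    have hcont : ContinuousOn g (Set.Icc b₁ b₂) :=
      hg_cont.mono fun x hx => ⟨by linarith [hx.1], by linarith [hx.2]⟩
    exact intermediate_value_Ioo' (by linarith) hcont ⟨hgb₂, hgb₁⟩
  have hβs0 : 0 < βs := by linarith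
  have hβs3 : βs < 1 - α := by linarith
  have hcrit : lam * (1 - α - βs) ^ d = βs * (1 - βs) ^ (d - 1) :=
    (deriv_slyPhi1_right_eq_zero_iff d hd hlam hα0 hβs0 (by linarith)).1 hgβs
  have hΦ_deriv : ∀ b ∈ Set.Ioo 0 (1 - α), HasDerivAt (fun b => slyPhi1 d lam α b) (g b) b :=
    fun b hb => hasDerivAt_slyPhi1_right d lam hα0 hb.1 (by linarith [hb.2])
  refine ⟨βs, hβs0, hβs3, hcrit, ?_, ?_⟩
  · intro β hβ0 hβ1 hβ
    have hgβ : g β = 0 := (deriv_slyPhi1_right_eq_zero_iff d hd hlam hα0 hβ0 (by linarith)).2 hβ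
    exact hg_anti.injOn ⟨hβ0, hβ1⟩ ⟨hβs0, hβs3⟩ (hgβ.trans hgβs.symm)
  · intro β hβ0 hβ1 hne
    rcases lt_or_gt_of_ne hne with hlt | hgt
    · -- `β < βs`: `Φ₁(α, ·)` is strictly increasing on `[β, βs]`
      have hmono : StrictMonoOn (fun b => slyPhi1 d lam α b) (Set.Icc β βs) := by
        refine strictMonoOn_of_deriv_pos (convex_Icc _ _) ?_ ?_
        · exact fun b hb =>
            (hΦ_deriv b ⟨by linarith [hb.1], by linarith [hb.2]⟩).continuousAt.continuousWithinAt
        · intro b hb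
          rw [interior_Icc] at hb
          rw [(hΦ_deriv b ⟨by linarith [hb.1], by linarith [hb.2]⟩).deriv]
          have := hg_anti ⟨(by linarith [hb.1] : (0 : ℝ) < b), (by linarith [hb.2] : b < 1 - α)⟩
            ⟨hβs0, hβs3⟩ hb.2
          linarith
      exact hmono ⟨le_rfl, hlt.le⟩ ⟨hlt.le, le_rfl⟩ hlt
    · -- `βs < β`: strictly decreasing on `[βs, β]`
      have hanti : StrictAntiOn (fun b => slyPhi1 d lam α b) (Set.Icc βs β) := by
        refine strictAntiOn_of_deriv_neg (convex_Icc _ _) ?_ ?_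
        · exact fun b hb =>
            (hΦ_deriv b ⟨by linarith [hb.1], by linarith [hb.2]⟩).continuousAt.continuousWithinAt
        · intro b hb
          rw [interior_Icc] at hb
          rw [(hΦ_deriv b ⟨by linarith [hb.1], by linarith [hb.2]⟩).deriv]
          have := hg_anti ⟨hβs0, hβs3⟩
            ⟨(by linarith [hb.1] : (0 : ℝ) < b), (by linarith [hb.2] : b < 1 - α)⟩ hb.1
          linarith
      exact hanti ⟨le_rfl, hgt.le⟩ ⟨hgt.le, le_rfl⟩ hgt

/-- **DFJ's function `h`** (Dyer–Frieze–Jerrum 2002, as quoted in Sly §1.3):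
`h(x) = (1-x)[1 - (x/(λ(1-x)))^{1/d}]`. [cite: Sly2010, §1.3 (first bullet, definition of `h`)] -/
noncomputable def dfjH (d : ℕ) (lam x : ℝ) : ℝ :=
  (1 - x) * (1 - (x / (lam * (1 - x))) ^ ((d : ℝ)⁻¹))

/-- Unfolding lemma for `dfjH`. [cite: Sly2010, §1.3 (definition of `h`)] -/
theorem dfjH_def (d : ℕ) (lam x : ℝ) :
    dfjH d lam x = (1 - x) * (1 - (x / (lam * (1 - x))) ^ ((d : ℝ)⁻¹)) := rfl

/-- **The critical equation in `β` is `α = h(β)`.** For `d ≥ 1`, `λ > 0`, `α ≥ 0`, `β > 0`,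
`α + β < 1`: `λ(1-α-β)^d = β(1-β)^{d-1} ⟺ α = h(β)` with DFJ's `h` (`dfjH`); by the symmetry of
`Φ₁` the critical equation in `α` is likewise `β = h(α)`, so the critical points of `Φ₁` are "the
solutions to `h(α) = β`, `h(β) = α`". [cite: Sly2010, §1.3 (first bullet, after DFJ02 Claim 2.2)] -/
theorem slyPhi1_critical_iff_eq_dfjH (d : ℕ) (hd : 1 ≤ d) {lam α β : ℝ} (hlam : 0 < lam)
    (hα : 0 ≤ α) (hβ : 0 < β) (hαβ : α + β < 1) :
    lam * (1 - α - β) ^ d = β * (1 - β) ^ (d - 1) ↔ α = dfjH d lam β := by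
  have h1 : 0 < 1 - α - β := by linarith
  have h2 : 0 < 1 - β := by linarith
  have hden : 0 < lam * (1 - β) := mul_pos hlam h2
  -- normalise: `λ(1-α-β)^d = β(1-β)^{d-1}` iff `((1-α-β)/(1-β))^d = β/(λ(1-β))`
  have step1 : lam * (1 - α - β) ^ d = β * (1 - β) ^ (d - 1) ↔
      ((1 - α - β) / (1 - β)) ^ d = β / (lam * (1 - β)) := by
    rw [div_pow, div_eq_div_iff (pow_ne_zero _ h2.ne') hden.ne']
    obtain ⟨k, rfl⟩ : ∃ k, d = k + 1 := ⟨d - 1, by omega⟩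
    rw [Nat.add_sub_cancel]
    constructor
    · intro h
      calc (1 - α - β) ^ (k + 1) * (lam * (1 - β)) = lam * (1 - α - β) ^ (k + 1) * (1 - β) := by ring
        _ = β * (1 - β) ^ k * (1 - β) := by rw [h]
        _ = β * (1 - β) ^ (k + 1) := by ring
    · intro h
      have : (lam * (1 - α - β) ^ (k + 1) - β * (1 - β) ^ k) * (1 - β) = 0 := by linear_combination h
      rcases mul_eq_zero.1 this with h' | h'
      · exact sub_eq_zero.1 h'
      · exact absurd h' h2.ne'
  -- take `d`-th roots: for nonnegative reals `u^d = w ⟺ u = w^{1/d}`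
  have step2 : ((1 - α - β) / (1 - β)) ^ d = β / (lam * (1 - β)) ↔
      (1 - α - β) / (1 - β) = (β / (lam * (1 - β))) ^ ((d : ℝ)⁻¹) := by
    have hu : 0 ≤ (1 - α - β) / (1 - β) := div_nonneg h1.le h2.le
    have hw : 0 ≤ β / (lam * (1 - β)) := div_nonneg hβ.le hden.le
    constructor
    · intro h
      rw [← h, Real.pow_rpow_inv_natCast hu (by omega)]
    · intro h
      rw [h, Real.rpow_inv_natCast_pow hw (by omega)]
  rw [step1, step2, dfjH_def]
  constructor
  · intro h
    have : 1 - α - β = (1 - β) * (β / (lam * (1 - β))) ^ ((d : ℝ)⁻¹) := by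
      rw [← h]; field_simp
    linarith [this]
  · intro h
    rw [div_eq_iff h2.ne']
    linarith [h]

end Literature.Computability.Complexity
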